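import Summits.Ventures.PercRepro.ProfileSeriesCount
import Summits.Ventures.PercRepro.ProfileGapMonoQ

/-!
# PercRepro — (GM)_1 IN THE MAIN CASE: THE CO-RANK-1 GAP IS DELETION-MONOTONE AT EVERY NON-COLOOP OF A SIMPLE
MATROID OF RANK ≥ u+1 (p10, gen 7; `proofs/P10-AVFULL.md` §9)

**THEOREM** (`gapMonoQ_one_of_simple`): for a simple matroid `M`, a point `z` that is not a coloop, and `2 ≤ u`
with `ρ(E) ≥ u + 1`: `GapMonoQ M z 1 u` — the instance `q = 1` of the gap-monotonicity conjecture of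
ProfileGapMonoQ, at every such point.  Proof.  In this regime the co-rank-1 level sets are the full level sets
(`levelSetCoQ_one_eq_levelSet`), so by the level split the supply is `u · #{A : ρ_{M／z}(A) = u − 1}`; the rank-1
sets of a simple matroid are its points (`Rq_one_eq_image_singleton`), and the demand of a point `x ≠ z` drops
under the deletion of `z` exactly by `C(ρ(E)−1, u−2)` when `x` is a **series partner** of `z` (`{x, z}` a
cocircuit, `seriesPartners`) and not at all otherwise (`demand_singleton_delete_add`); the series partners form
a series set of `M ／ z` (`seriesSet_contract_seriesPartners`), and ProfileSeriesCount's assembly gives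
`C(ρ(E), u−1) + #partners · C(ρ(E)−1, u−2) ≤ u · #{A : ρ_{M／z}(A) = u − 1}`.  The circuit `U_{R,R+1}` is tight.
Below `u + 1` the statement is trivial (`u > ρ(E)`) or the top level (ProfileGapMonoTop); the remaining cases of
(GM)_1 are `z` a coloop and non-simple `M`.

* `mul_choose_shift_le'`, `lemmaE'`, `choose_add_mul_le_of_seriesSet'` (the relaxed arithmetic: one unit of rank less than
  ProfileSeriesCount's versions — needed for `ρ(E) = u + 1`);
* `rk_inter_add_rk_union_le'`, `rk_gr_le_rk_add_rk_sdiff`, `Rq_one_eq_image_singleton`, `demand_singleton_eq`,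
  `demand_delete_singleton_eq`, `seriesPartners`, `erase_erase_comm'`, `demand_singleton_delete_add`;
* `levelSetCoQ_one_eq_levelSet`, `seriesSet_contract_seriesPartners`, **`gapMonoQ_one_of_simple`**.
-/

open scoped Matroid

namespace PercRepro.Cogirth

open Finset ThmH Skew Shadow Profile

variable {α : Type} [DecidableEq α]

/-! ### The relaxed arithmetic and assembly (the tree's versions ask for one more unit of rank) -/

/-- **The arithmetic core, relaxed** (`u + 1 ≤ R`; the tree's `mul_choose_shift_le` has `u + 2 ≤ R`): `u · C(R−s, u−1−s) ≤ (R−s) · C(R−1, u−2)` for `2 ≤ u`, `u + 1 ≤ R`, `1 ≤ s ≤ u−1`. -/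
theorem mul_choose_shift_le' {u R s : ℕ} (hu : 2 ≤ u) (hR : u + 1 ≤ R) (hs1 : 1 ≤ s) (hsu : s ≤ u - 1) :
    u * (R - s).choose (u - 1 - s) ≤ (R - s) * (R - 1).choose (u - 2) := by
  have hP : 0 < (R - 1).descFactorial (s - 1) := by
    rw [Nat.pos_iff_ne_zero, Ne, Nat.descFactorial_eq_zero_iff_lt]
    omega
  apply Nat.le_of_mul_le_mul_left _ hP
  -- `P_R · u · C(R−s, u−1−s) = u · P_u · C(R−1, u−2)` by the shift identity
  have hshift := descFactorial_mul_choose_shift (R := R) hs1 hsu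
  calc (R - 1).descFactorial (s - 1) * (u * (R - s).choose (u - 1 - s))
      = u * ((R - 1).descFactorial (s - 1) * (R - s).choose (u - 1 - s)) := by ring
    _ = u * ((u - 2).descFactorial (s - 1) * (R - 1).choose (u - 2)) := by rw [hshift]
    _ = (u * (u - 2).descFactorial (s - 1)) * (R - 1).choose (u - 2) := by ring
    _ ≤ ((R - 1).descFactorial s) * (R - 1).choose (u - 2) := by
        apply Nat.mul_le_mul_right
        -- `u · (u−2).descFactorial (s−1) ≤ (R−1) · (R−2).descFactorial (s−1) = (R−1).descFactorial s`
        have h1 : (R - 1).descFactorial s = (R - 1) * (R - 2).descFactorial (s - 1) := by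
          have := Nat.succ_descFactorial_succ (R - 2) (s - 1)
          rw [show R - 2 + 1 = R - 1 by omega, show s - 1 + 1 = s by omega] at this
          exact this
        rw [h1]
        apply Nat.mul_le_mul (by omega)
        exact Nat.descFactorial_le _ (by omega)
    _ = (R - 1).descFactorial (s - 1) * ((R - s) * (R - 1).choose (u - 2)) := by
        have h2 : (R - 1).descFactorial s = (R - s) * (R - 1).descFactorial (s - 1) := by
          have := Nat.descFactorial_succ (R - 1) (s - 1)
          rw [show s - 1 + 1 = s by omega, show R - 1 - (s - 1) = R - s by omega] at this
          exact this
        rw [h2]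
        ring

/-- **Lemma E, relaxed** (`u + 1 ≤ R`): `C(R,u−1) + s · C(R−1,u−2) + u · [s ≤ u−1] · C(R−s, u−1−s) ≤ u · C(R, u−1)` for `2 ≤ u`,
`u + 1 ≤ R`, `1 ≤ s ≤ R`. -/
theorem lemmaE' {u R s : ℕ} (hu : 2 ≤ u) (hR : u + 1 ≤ R) (hs1 : 1 ≤ s) (hsR : s ≤ R) :
    R.choose (u - 1) + s * (R - 1).choose (u - 2) +
      u * (if s ≤ u - 1 then (R - s).choose (u - 1 - s) else 0) ≤ u * R.choose (u - 1) := by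
  -- `(u−1) · C(R, u−1) = R · C(R−1, u−2)`
  have hkey : R * (R - 1).choose (u - 2) = R.choose (u - 1) * (u - 1) := by
    have := Nat.add_one_mul_choose_eq (R - 1) (u - 2)
    rw [show R - 1 + 1 = R by omega, show u - 2 + 1 = u - 1 by omega] at this
    exact this
  have hu' : u * R.choose (u - 1) = R.choose (u - 1) + R * (R - 1).choose (u - 2) := by
    rw [hkey]
    calc u * R.choose (u - 1) = (u - 1 + 1) * R.choose (u - 1) := by
          congr 1
          omega
      _ = R.choose (u - 1) + R.choose (u - 1) * (u - 1) := by ring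
  rw [hu']
  split_ifs with hsu
  · have := mul_choose_shift_le' hu hR hs1 hsu
    have hsplit : R * (R - 1).choose (u - 2) = s * (R - 1).choose (u - 2) + (R - s) * (R - 1).choose (u - 2) := by
      rw [← Nat.add_mul, Nat.add_sub_cancel' hsR]
    omega
  · have : s * (R - 1).choose (u - 2) ≤ R * (R - 1).choose (u - 2) := Nat.mul_le_mul_right _ hsR
    omega

/-- **The assembly in `N`, relaxed** (`u ≤ ρ(E)`; the tree's `choose_add_mul_le_of_seriesSet` has `u + 1 ≤ ρ(E)`): for a nonempty series set `Z` (`s := #Z`) of a matroid of rank `R' ≥ u`, `u ≥ 2`: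
`C(R'+1, u−1) + s · C(R', u−2) ≤ u · #{A : ρ(A) = u − 1}`. -/
theorem choose_add_mul_le_of_seriesSet' {N : Matroid α} [N.Finite] {Z : Finset α} (hZ : SeriesSet N Z) (hne : Z.Nonempty) {u : ℕ}
    (hu : 2 ≤ u) (hR : u ≤ rk N (gr N)) :
    (rk N (gr N) + 1).choose (u - 1) + Z.card * (rk N (gr N)).choose (u - 2) ≤
      u * (levelSet N (u - 1)).card := by
  have hs1 : 1 ≤ Z.card := card_pos.2 hne
  have hC := rk_sdiff_seriesSet_add hZ hne
  have hD := sum_choose_le_card_levelSet_of_seriesSet hZ u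
  have hV := sum_choose_filter_add_eq Z.card (rk N (gr N \ Z)) u (by omega)
  have hsum : Z.card + rk N (gr N \ Z) = rk N (gr N) + 1 := by omega
  rw [hsum] at hV
  have hE := lemmaE' (u := u) (R := rk N (gr N) + 1) (s := Z.card) hu (by omega) hs1 (by omega)
  rw [show rk N (gr N) + 1 - Z.card = rk N (gr N \ Z) by omega,
    show rk N (gr N) + 1 - 1 = rk N (gr N) by omega] at hE
  have hmul : u * (∑ i ∈ (range u).filter (fun i => i ≠ Z.card),
      Z.card.choose i * (rk N (gr N \ Z)).choose (u - 1 - i)) ≤ u * (levelSet N (u - 1)).card :=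
    Nat.mul_le_mul_left _ hD
  have hmul2 : u * (∑ i ∈ (range u).filter (fun i => i ≠ Z.card),
      Z.card.choose i * (rk N (gr N \ Z)).choose (u - 1 - i)) +
      u * (if Z.card ≤ u - 1 then (rk N (gr N \ Z)).choose (u - 1 - Z.card) else 0) =
      u * (rk N (gr N) + 1).choose (u - 1) := by
    rw [← Nat.mul_add, hV]
  omega


/-! ### The rank-1 sets and the demands of a simple matroid -/

section Simple

variable {M : Matroid α} [M.Finite]

/-- Submodularity in the ℕ rank: `ρ(X ∩ Y) + ρ(X ∪ Y) ≤ ρ(X) + ρ(Y)`. -/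
theorem rk_inter_add_rk_union_le' (X Y : Finset α) : rk M (X ∩ Y) + rk M (X ∪ Y) ≤ rk M X + rk M Y := by
  have h := M.eRk_inter_add_eRk_union_le (X : Set α) (Y : Set α)
  rw [← coe_inter, ← coe_union, ← coe_rk, ← coe_rk, ← coe_rk, ← coe_rk] at h
  exact_mod_cast h

/-- `ρ(E) ≤ ρ(S) + ρ(E ∖ S)`. -/
theorem rk_gr_le_rk_add_rk_sdiff (S : Finset α) : rk M (gr M) ≤ rk M S + rk M (gr M \ S) := by
  have h := M.eRk_union_le_eRk_add_eRk (S : Set α) ((gr M \ S : Finset α) : Set α)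
  rw [← coe_union, ← coe_rk, ← coe_rk, ← coe_rk] at h
  have hmono : rk M (gr M) ≤ rk M (S ∪ (gr M \ S)) := rk_mono_sub (by
    intro x hx
    rw [mem_union, mem_sdiff]
    by_cases hxS : x ∈ S
    · exact Or.inl hxS
    · exact Or.inr ⟨hx, hxS⟩)
  have h' : rk M (S ∪ (gr M \ S)) ≤ rk M S + rk M (gr M \ S) := by exact_mod_cast h
  omega

/-- In a simple matroid the rank-1 sets are the singletons. -/
theorem Rq_one_eq_image_singleton (hs : Simple' M) : Rq M 1 = (gr M).image (fun x => ({x} : Finset α)) := by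
  ext B
  rw [mem_Rq, mem_image]
  constructor
  · rintro ⟨hBg, hBr⟩
    have hr : rk M B = 1 := by unfold rk; rw [hBr, ENat.toNat_coe]
    have hle : rk M B ≤ B.card := rk_le_card B
    have hcard : B.card = 1 := by
      by_contra hne
      rcases Nat.lt_or_ge B.card 2 with hlt | hge
      · -- `#B ≤ 1` and `#B ≠ 1`: `B = ∅`, rank `0`
        have h0 : B.card = 0 := by omega
        rw [card_eq_zero] at h0
        subst h0
        unfold rk at hr
        simp at hr
      · -- a 2-subset of `B` is independent of rank 2 ≤ ρ(B) = 1
        obtain ⟨P, hPB, hPc⟩ := exists_subset_card_eq hge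
        have hPind := hs P (hPB.trans hBg) (by omega)
        have hPr : rk M P = P.card := rk_eq_card_of_indep hPind
        have := rk_mono_sub (M := M) hPB
        omega
    obtain ⟨x, hx⟩ := card_eq_one.1 hcard
    exact ⟨x, hBg (hx ▸ mem_singleton_self x), hx.symm⟩
  · rintro ⟨x, hx, rfl⟩
    refine ⟨singleton_subset_iff.2 hx, ?_⟩
    have hind := hs {x} (singleton_subset_iff.2 hx) (by simp)
    rw [← coe_rk, rk_eq_card_of_indep hind, card_singleton]

/-- The demand of a point of `M`, read off `ρ(E ∖ x)`. -/
theorem demand_singleton_eq (u : ℕ) (x : α) :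
    demand M 1 u {x} =
      if u ≤ rk M ((gr M).erase x) then (rk M ((gr M).erase x)).choose (u - 1) else 0 := by
  unfold demand
  rw [sdiff_singleton_eq_erase]

/-- The demand of a point `x` in `M ∖ z`, read off `ρ(E ∖ x ∖ z)`. -/
theorem demand_delete_singleton_eq (u : ℕ) (x z : α) :
    demand (M ＼ ({z} : Set α)) 1 u {x} =
      if u ≤ rk M (((gr M).erase x).erase z) then (rk M (((gr M).erase x).erase z)).choose (u - 1) else 0 := by
  rw [demand_delete_eq_ite', sdiff_singleton_eq_erase]

/-- **The series partners of `z`**: the points `x ≠ z` that are not coloops and such that erasing `x` from `E ∖ z`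
drops the rank (`{x, z}` is a cocircuit). -/
noncomputable def seriesPartners (M : Matroid α) [M.Finite] (z : α) : Finset α :=
  ((gr M).erase z).filter (fun x => rk M ((gr M).erase x) = rk M (gr M) ∧
    rk M (((gr M).erase z).erase x) + 1 = rk M (gr M))

/-- Erasing `x` then `z` or `z` then `x`. -/
theorem erase_erase_comm' (E : Finset α) (x z : α) : (E.erase x).erase z = (E.erase z).erase x :=
  erase_right_comm

/-- **The demand of a point under the deletion of `z`**: for `x ∈ E ∖ z`, with `z` not a coloop of `M` and
`ρ(E) ≥ u + 1`, `demand_M(x) = demand_{M∖z}(x) + [x ∈ seriesPartners] · C(ρ(E) − 1, u − 2)`. -/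
theorem demand_singleton_delete_add {z : α} (hz : z ∈ gr M) (hzc : rk M ((gr M).erase z) = rk M (gr M))
    {u : ℕ} (hu : 2 ≤ u) (hR : u + 1 ≤ rk M (gr M)) {x : α} (hx : x ∈ (gr M).erase z) :
    demand M 1 u {x} = demand (M ＼ ({z} : Set α)) 1 u {x} +
      (if x ∈ seriesPartners M z then (rk M (gr M) - 1).choose (u - 2) else 0) := by
  rw [demand_singleton_eq, demand_delete_singleton_eq, erase_erase_comm']
  have hxz : x ≠ z := (mem_erase.1 hx).1
  have hxE : x ∈ gr M := (mem_erase.1 hx).2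
  -- the ranks: `ρ(E ∖ x ∖ z) ≤ ρ(E ∖ x) ≤ ρ(E ∖ x ∖ z) + 1`, `ρ(E ∖ z) − 1 ≤ ρ(E ∖ x ∖ z)`, `ρ(E ∖ x) ≤ ρ(E)`
  have h1 : rk M (((gr M).erase z).erase x) ≤ rk M ((gr M).erase x) := by
    rw [← erase_erase_comm']
    exact rk_mono_sub (erase_subset _ _)
  have h2 : rk M ((gr M).erase x) ≤ rk M (((gr M).erase z).erase x) + 1 := by
    have h := rk_insert_le (M := M) z (((gr M).erase x).erase z)
    rw [insert_erase (mem_erase.2 ⟨Ne.symm hxz, hz⟩), erase_erase_comm'] at h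
    exact h
  have h3 : rk M ((gr M).erase z) ≤ rk M (((gr M).erase z).erase x) + 1 := by
    have h := rk_insert_le (M := M) x (((gr M).erase z).erase x)
    rw [insert_erase hx] at h
    exact h
  have h4 : rk M ((gr M).erase x) ≤ rk M (gr M) := rk_mono_sub (erase_subset _ _)
  by_cases hxZ : x ∈ seriesPartners M z
  · rw [if_pos hxZ]
    unfold seriesPartners at hxZ
    rw [mem_filter] at hxZ
    obtain ⟨_, hxr, hxzr⟩ := hxZ
    rw [hxr, if_pos (by omega), show rk M (((gr M).erase z).erase x) = rk M (gr M) - 1 by omega,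
      if_pos (by omega)]
    -- Pascal: `C(R, u−1) = C(R−1, u−2) + C(R−1, u−1)`
    have := Nat.choose_succ_succ' (rk M (gr M) - 1) (u - 2)
    rw [show rk M (gr M) - 1 + 1 = rk M (gr M) by omega, show u - 2 + 1 = u - 1 by omega] at this
    rw [this]
    ring
  · rw [if_neg hxZ, add_zero]
    -- `x ∉ seriesPartners`: the two ranks agree
    have heq : rk M (((gr M).erase z).erase x) = rk M ((gr M).erase x) := by
      unfold seriesPartners at hxZ
      rw [mem_filter, not_and_or] at hxZ
      rcases hxZ with h | h
      · exact absurd hx h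
      · rw [not_and_or] at h
        rcases h with h | h
        · -- `x` is a coloop of `M`: `ρ(E ∖ x) = ρ(E) − 1 ≤ ρ(E ∖ x ∖ z)`
          omega
        · -- `x` is not a coloop and `ρ(E ∖ z ∖ x) ≠ ρ(E) − 1`
          omega
    rw [heq]

end Simple

/-! ### The co-rank-1 level sets in the regime `ρ(E) ≥ u + 2`, the series set of `M ／ z`, and the theorem -/

section Main

variable {M : Matroid α} [M.Finite]

/-- When `ρ(E) ≥ u + 1`, every rank-`u` set has a complement of rank `≥ 1`: `levelSetCoQ M 1 u = levelSet M u`. -/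
theorem levelSetCoQ_one_eq_levelSet {u : ℕ} (hR : u + 1 ≤ rk M (gr M)) : levelSetCoQ M 1 u = levelSet M u := by
  ext S
  rw [mem_levelSetCoQ, mem_levelSet]
  constructor
  · exact fun h => h.1
  · intro h
    refine ⟨h, ?_⟩
    have hr : rk M S = u := by unfold rk; rw [h.2, ENat.toNat_coe]
    have := rk_gr_le_rk_add_rk_sdiff (M := M) S
    omega

/-- **The series partners of `z` form a series set of `M ／ z`** (`z` a non-loop, not a coloop). -/
theorem seriesSet_contract_seriesPartners {z : α} (hzI : M.Indep {z}) (hzc : rk M ((gr M).erase z) = rk M (gr M)) :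
    SeriesSet (M ／ ({z} : Set α)) (seriesPartners M z) := by
  have hz : z ∈ gr M := mem_gr_of_indep hzI
  have hgrN : gr (M ／ ({z} : Set α)) = (gr M).erase z := gr_contract'
  have hrkN : ∀ X ⊆ (gr M).erase z, rk (M ／ ({z} : Set α)) X + 1 = rk M (insert z X) :=
    fun X hX => rk_contract_add_one hzI hX
  have hN : rk (M ／ ({z} : Set α)) ((gr M).erase z) + 1 = rk M (gr M) := by
    rw [hrkN _ (Subset.refl _), insert_erase hz]
  refine ⟨?_, ?_, ?_⟩
  · rw [hgrN]
    exact filter_subset _ _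
  · intro x hx
    unfold seriesPartners at hx
    rw [mem_filter] at hx
    obtain ⟨hxE, hxr, hxzr⟩ := hx
    have hxz : x ≠ z := (mem_erase.1 hxE).1
    have h := hrkN (((gr M).erase z).erase x) (erase_subset _ _)
    have hins : insert z (((gr M).erase z).erase x) = (gr M).erase x := by
      rw [← erase_erase_comm' (gr M) x z]
      exact insert_erase (mem_erase.2 ⟨Ne.symm hxz, hz⟩)
    rw [hins, hxr] at h
    rw [hgrN]
    omega
  · intro x hx y hy hxy
    unfold seriesPartners at hx hy
    rw [mem_filter] at hx hy
    obtain ⟨hxE, hxr, hxzr⟩ := hx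
    obtain ⟨hyE, hyr, hyzr⟩ := hy
    have hxz : x ≠ z := (mem_erase.1 hxE).1
    have hyz : y ≠ z := (mem_erase.1 hyE).1
    -- submodularity in `M` on `E ∖ z ∖ x` and `E ∖ z ∖ y`
    have hsub := rk_inter_add_rk_union_le' (M := M) (((gr M).erase z).erase x) (((gr M).erase z).erase y)
    have hunion : ((gr M).erase z).erase x ∪ ((gr M).erase z).erase y = (gr M).erase z := by
      ext w
      simp only [mem_union, mem_erase]
      constructor
      · rintro (⟨_, h⟩ | ⟨_, h⟩) <;> exact h
      · intro h
        by_cases hwx : w = x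
        · exact Or.inr ⟨fun h' => hxy (hwx.symm.trans h'), h⟩
        · exact Or.inl ⟨hwx, h⟩
    have hinter : ((gr M).erase z).erase x ∩ ((gr M).erase z).erase y = (((gr M).erase z).erase x).erase y := by
      ext w
      simp only [mem_inter, mem_erase]
      tauto
    rw [hunion, hinter, hzc] at hsub
    -- `ρ(E ∖ z ∖ x ∖ y) ≤ ρ(E) − 2`, hence `ρ(E ∖ x ∖ y) ≤ ρ(E) − 1`
    have h1 : rk M ((((gr M).erase z).erase x).erase y) + 2 ≤ rk M (gr M) := by omega
    have h2 := rk_insert_le (M := M) z ((((gr M).erase z).erase x).erase y)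
    have h3 := hrkN ((((gr M).erase z).erase x).erase y) ((erase_subset _ _).trans (erase_subset _ _))
    rw [hgrN]
    omega

/-- **THEOREM ((GM)_1, the main case)**: in a simple matroid of rank `≥ u + 1` (`u ≥ 2`), the co-rank-1 gap is
deletion-monotone at every point `z` that is not a coloop: `GapMonoQ M z 1 u`. -/
theorem gapMonoQ_one_of_simple (hs : Simple' M) {z : α} (hz : z ∈ gr M)
    (hzc : rk M ((gr M).erase z) = rk M (gr M)) {u : ℕ} (hu : 2 ≤ u) (hR : u + 1 ≤ rk M (gr M)) :
    GapMonoQ M z 1 u := by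
  have hzI : M.Indep {z} := by
    have := hs {z} (singleton_subset_iff.2 hz) (by simp)
    rwa [coe_singleton] at this
  unfold GapMonoQ
  -- the demands of `M` and of `M ∖ z`, as sums over the points
  have hinj : ∀ (E : Finset α), ∀ x ∈ E, ∀ y ∈ E, ({x} : Finset α) = {y} → x = y :=
    fun _ x _ y _ h => singleton_inj.1 h
  have hD : ∑ B ∈ Rq M 1, demand M 1 u B = ∑ x ∈ gr M, demand M 1 u {x} := by
    rw [Rq_one_eq_image_singleton hs, sum_image (hinj _)]
  have hD' : ∑ B ∈ Rq (M ＼ ({z} : Set α)) 1, demand (M ＼ ({z} : Set α)) 1 u B =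
      ∑ x ∈ (gr M).erase z, demand (M ＼ ({z} : Set α)) 1 u {x} := by
    rw [Rq_one_eq_image_singleton (simple'_delete hs z), gr_delete', sum_image (hinj _)]
  have hsplitD : ∑ x ∈ gr M, demand M 1 u {x} =
      demand M 1 u {z} + ∑ x ∈ (gr M).erase z, demand M 1 u {x} := (add_sum_erase _ _ hz).symm
  have hdz : demand M 1 u {z} = (rk M (gr M)).choose (u - 1) := by
    rw [demand_singleton_eq, hzc, if_pos (by omega)]
  have hrest : ∑ x ∈ (gr M).erase z, demand M 1 u {x} =
      ∑ x ∈ (gr M).erase z, demand (M ＼ ({z} : Set α)) 1 u {x} +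
        (seriesPartners M z).card * (rk M (gr M) - 1).choose (u - 2) := by
    rw [sum_congr rfl (fun x hx => demand_singleton_delete_add hz hzc hu hR hx), sum_add_distrib]
    congr 1
    have hsub : seriesPartners M z ⊆ (gr M).erase z := by
      unfold seriesPartners
      exact filter_subset _ _
    rw [sum_ite_mem, inter_eq_right.2 hsub, sum_const, smul_eq_mul]
  -- the co-rank-1 level sets are the full level sets here
  have hL : levelSetCoQ M 1 u = levelSet M u := levelSetCoQ_one_eq_levelSet (by omega)
  have hL' : levelSetCoQ (M ＼ ({z} : Set α)) 1 u = levelSet (M ＼ ({z} : Set α)) u := by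
    apply levelSetCoQ_one_eq_levelSet
    rw [gr_delete', rk_delete (Subset.refl _), hzc]
    omega
  have hsplitL := card_levelSet_split hzI (u := u) (by omega)
  -- the contraction
  have hN : rk (M ／ ({z} : Set α)) (gr (M ／ ({z} : Set α))) + 1 = rk M (gr M) := by
    rw [gr_contract', rk_contract_add_one hzI (Subset.refl _), insert_erase hz]
  have hN' : rk (M ／ ({z} : Set α)) (gr (M ／ ({z} : Set α))) = rk M (gr M) - 1 := by omega
  have hkey : (rk M (gr M)).choose (u - 1) + (seriesPartners M z).card * (rk M (gr M) - 1).choose (u - 2) ≤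
      u * (levelSet (M ／ ({z} : Set α)) (u - 1)).card := by
    rcases (seriesPartners M z).eq_empty_or_nonempty with hemp | hne
    · rw [hemp, card_empty, Nat.zero_mul, add_zero]
      have := choose_succ_le_mul_card_levelSet (M ／ ({z} : Set α)) hu (by omega)
      rw [hN] at this
      exact this
    · have := choose_add_mul_le_of_seriesSet' (seriesSet_contract_seriesPartners hzI hzc) hne hu (by omega)
      rw [hN, hN'] at this
      exact this
  rw [hD, hD', hsplitD, hdz, hrest, hL, hL', hsplitL, Nat.choose_one_right]
  nlinarith [hkey]

end Main

end PercRepro.Cogirth
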